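import Mathlib.NumberTheory.DirichletCharacter.Basic
import Literature.NumberTheory.EllipticCurves.PAdicHeights
import HarnessLib

/-!
# Line heights: the `3`-adic height of an elliptic curve attached to a rank-one crystalline
# `(φ,Γ)`-submodule (Nekovář–Benois), as a hypothesis structure — `PSLineHeightData`, `IsPSLineHeight`

Topic `Literature/NumberTheory/EllipticCurves`; ONE data structure + one predicate + API lemmas
(proved); NO named fact, no existence statement. Definition request `defn-PSLineHeight`
(planner-bsd-wall-pss3 g7; route `CyclotomicUntwist` of the summit `BirchSwinnertonDyer`, two-layer plan
of the crux `PSRankOneLowerHalfAtThree` = stmt-BirchSwinnertonDyer-21580, request D2): "the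
Nekovář–Benois 3-adic height `h_ψ` on `E(ℚ) ⊗ ℚ₃(ζ₃)` attached to the rank-one crystalline
`(φ,Γ)`-submodule `F_ψ ⊂ D_rig(V₃E ⊗ ℚ₃(ζ₃))` which exists exactly on the principal-series rows at a
wild `3` … as data + Prop axioms `IsPSLineHeight W ψ h`: symmetric bilinear, Galois-equivariant with
`h_ψ̄ = σ ∘ h_ψ` for `σ ∈ Gal(ℚ₃(ζ₃)/ℚ₃)`, equal to the universal-norm height of the splitting `F_ψ`; no
existence smuggled."

## The printed object (what the datum is INTENDED to be)

Benois, *p-adic heights and p-adic Hodge theory*, Mém. SMF 167 (2020) = arXiv:1412.7305 (held text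
`paper:arxiv-1412.7305`, locators `pNNNN:Lnn`), §0.3: for a `p`-adic representation `V` of `G_{ℚ,S}`
with coefficients in a finite extension `E/ℚ_p` and a family `𝔻 = (𝔻_q)_{q ∈ S_p}` of
`(φ,Γ)`-submodules of `D†_rig(V_q)`, the height `h^{sel}_{V,𝔻,1} : H¹(V,𝔻) × H¹(V*(1),𝔻^⊥) → E`
(p0004:L90–102, "The `p`-adic height pairing associated to the data `(V,𝔻)`", Bockstein map ∘ cup
product; Thm. I: (skew-)symmetry), the universal-norm height `h^{norm}_{V,D}` (p0005:L1, Thm. II: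
`h^{norm}_{V,D} = h^{sel}_{V,𝔻,1}` under N1–2), and for a SPLITTING SUBMODULE `D_q ⊂ D_{st/L}(V_q)`
(p0005:L31: "a `(φ,N,G_{L/F_q})`-submodule `D_q` … is a splitting submodule if
`D_{dR/L}(V_q) = D_{q,L} ⊕ F⁰D_{dR/L}(V_q)`") the pairing `h^{spl}_{V,D} : H¹_f(V) × H¹_f(V*(1)) → E`
(p0005:L41), with Thm. III: `h^{sel} = h^{norm} = h^{spl}` under S) and N2). INTENDED INSTANCE here:
`p = 3`, `S_p = {3}`, `V = V₃(E) ⊗_{ℚ₃} R` with `R = ℚ₃(ζ₃)` (`CyclotomicField 3 ℚ_[3]`), `E/ℚ` with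
additive potentially good reduction at `3` becoming good over an abelian totally ramified `L/ℚ₃`
(the tree's `TypeGNine` rows); `G_{L/ℚ₃}` acts on `D_{cris/L}(V)` through two conjugate characters and,
for a Dirichlet character `ψ` mod `9` of order `3` with values in `R` (local class field theory),
`D_ψ :=` the `ψ`-eigenline, a `φ`-stable `(φ,G_{L/ℚ₃})`-submodule of rank one — a splitting submodule
exactly on the principal-series rows; `h_ψ :=` `h^{spl}_{V,D_ψ}` pulled back to `E(ℚ)` by the Kummer
map in both variables (`V ≅ V*(1)` by the Weil pairing). The analogue at a GOOD SUPERSINGULAR prime is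
Kobayashi 2013 §4 (heights for the two `φ`-eigenlines `α, β`) and Nekovář, *Selmer complexes* §11.

## What is typed (faithfulness sheet)

NONE of `D†_rig`, `(φ,Γ)`-modules, `D_cris`, Selmer complexes or universal norms exists in Mathlib, so —
exactly as for the tree's `WeierstrassCurve.PAdicHeightData` (`PAdicHeights.lean`: "hypothesis-structure
… the normalisation is NOT axiomatised … statements must quantify over `D`") and
`PAdicHeightDataK` — the notion is typed as a HYPOTHESIS STRUCTURE carrying the pairings and their
formal properties, with the printed construction as the documented intended instance:

* `WeierstrassCurve.PSLineHeightData W R` — for `E = W` over `ℚ` and a coefficient ring `R` which is a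
  `ℚ_[3]`-algebra (intended: `R = ℚ₃(ζ₃)`), a family of pairings
  `pairing χ : E(ℚ) →+ E(ℚ) →+ R` indexed by the Dirichlet characters `χ` mod `9` with values in `R`
  (the LINES `F_χ`), subject to: `symm` (symmetric — Benois Thm. I with the Weil pairing),
  `map_torsion` (vanishes on torsion — the pairing factors through `E(ℚ) ⊗ R`), `eq_zero_of_not_isLine`
  (only the characters of exact order `3` carry a line: `pairing χ = 0` unless `χ³ = 1 ∧ χ ≠ 1`), and
  `conj` — **Galois equivariance in the coefficients**: for every `σ ∈ Aut(R/ℚ₃)`,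
  `h_{σ∘χ} = σ ∘ h_χ` (the route's "`h_ψ̄ = σ ∘ h_ψ`": over `ℚ₃(ζ₃)` the non-trivial `σ` carries `ψ` to
  `ψ̄ = ψ⁻¹`; transport of structure of Benois's construction along `σ`, which carries `(V, D_ψ)` to
  `(V, D_{σψ})`). STATUS: FAITHFUL as a hypothesis structure; the clause "equal to the universal-norm
  height of `F_ψ`" (Benois Thm. II/III) is the INTENDED INSTANCE and is NOT axiomatised (no vocabulary)
  — flagged vacuity: the zero family is a datum (`PSLineHeightData.zero`), so consumers quantify over
  the datum and NO existence / canonicity is asserted anywhere in this file ("no existence smuggled").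
* `WeierstrassCurve.IsPSLineHeight W ψ h` — the same axioms as a `Prop` on a bare family `h` together
  with "`ψ` is a line" (`ψ³ = 1`, `ψ ≠ 1`), the shape named in the request; `PSLineHeightData.isPSLineHeight`
  and `PSLineHeightData.ofIsPSLineHeight` convert.
* API (proved): `map_torsion_right`, `pairing_ringHomComp_self` (`h_{σχ}(P,P) = σ(h_χ(P,P))`),
  `pairing_ringHomComp_eq_zero_iff`, `pairing_ne_zero_of_exists_ringHomComp` (the route's
  "σ-symmetric non-degeneracy": if SOME conjugate line is non-degenerate at `(P,Q)` then the `χ`-line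
  is), `pairing_inv_eq_of_ringHomComp_eq` (`h_{ψ̄} = σ ∘ h_ψ` when `σ ∘ ψ = ψ⁻¹`),
  `pairing_eq_zero_of_pow_three_ne_one`, `pairing_one`.

Honest framing: bookkeeping vocabulary for a conditional BSD route; nothing here is evidence for BSD,
and the structure can be inhabited by junk (by design, documented).

## References

* D. Benois, *p-adic heights and p-adic Hodge theory*, Mém. Soc. Math. Fr. 167 (2020), arXiv:1412.7305,
  §0.3 (pp. 4–5 of the held text: definitions of `h^{sel}`, `h^{norm}`, splitting submodules, `h^{spl}`;
  Thms. I–III). [Benois2020]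
* J. Nekovář, *Selmer complexes*, Astérisque 310 (2006), §11 (heights from Selmer complexes). [Nekovar2006]
* S. Kobayashi, *The p-adic Gross–Zagier formula for elliptic curves at supersingular primes*, Invent.
  Math. 191 (2013), §4 (the two eigenline heights at good supersingular `p`). [Kobayashi2013]
* B. Perrin-Riou, *Fonctions L p-adiques d'une courbe elliptique et points rationnels*, Ann. Inst.
  Fourier 43 (1993). [PerrinRiou1993AIF]
* P. Schneider, *p-adic height pairings I*, Invent. Math. 69 (1982), §1 (the shape: symmetric bilinear,
  killing torsion). [Schneider1982PadicHeightI]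
-/

noncomputable section

open scoped Classical

namespace WeierstrassCurve

variable (W : WeierstrassCurve ℚ) (R : Type*) [CommRing R] [Algebra ℚ_[3] R]

/-- **Hypothesis structure: line heights at `3`.** For `E/ℚ` given by `W` and a coefficient ring `R`
over `ℚ₃` (intended `R = ℚ₃(ζ₃)`), a family of symmetric bilinear pairings
`h_χ : E(ℚ) × E(ℚ) → R`, one for each Dirichlet character `χ` mod `9` with values in `R` of exact
order `3` (the LINE `F_χ`, a rank-one crystalline `(φ,Γ)`-submodule of `D†_rig(V₃E ⊗ R)`; zero for
the other `χ`), killing torsion, and GALOIS-EQUIVARIANT IN THE COEFFICIENTS: `h_{σ∘χ} = σ ∘ h_χ` for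
every `σ ∈ Aut(R/ℚ₃)`. Intended instance: Benois's `h^{spl}_{V,D_χ} = h^{norm} = h^{sel}` (§0.3,
Thm. III) pulled back along the Kummer map; the normalisation / universal-norm description is NOT
axiomatised (no `(φ,Γ)`-modules in Mathlib) — the zero family is a datum (`zero`), statements
quantify over the datum, no existence or canonicity is asserted.
[cite: Benois2020, §0.3 (Definition p0004:L90 "The p-adic height pairing associated to the data (V,𝔻)"; p0005:L31 splitting submodule; Thm. III)] -/
structure PSLineHeightData where
  /-- The pairings `h_χ : E(ℚ) →+ E(ℚ) →+ R`, indexed by the Dirichlet characters `χ` mod `9`. -/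
  pairing : DirichletCharacter R 9 → W.toAffine.Point →+ W.toAffine.Point →+ R
  /-- Symmetry `h_χ(P, Q) = h_χ(Q, P)`. -/
  symm : ∀ χ P Q, pairing χ P Q = pairing χ Q P
  /-- Each pairing vanishes on torsion points (in the first variable). -/
  map_torsion : ∀ χ P Q, IsOfFinAddOrder P → pairing χ P Q = 0
  /-- Only the characters of exact order `3` carry a line: `h_χ = 0` otherwise. -/
  eq_zero_of_not_isLine : ∀ χ, ¬ (χ ^ 3 = 1 ∧ χ ≠ 1) → pairing χ = 0
  /-- Galois equivariance in the coefficients: `h_{σ ∘ χ} = σ ∘ h_χ` for `σ ∈ Aut(R/ℚ₃)`. -/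
  conj : ∀ (σ : R ≃ₐ[ℚ_[3]] R) χ P Q,
    pairing (χ.ringHomComp (σ : R →+* R)) P Q = σ (pairing χ P Q)

variable {W R}

/-- **`IsPSLineHeight W ψ h`** (the request's shape): `ψ` is a line (a Dirichlet character mod `9` of
exact order `3`) and the family `h` of pairings `h_χ : E(ℚ) →+ E(ℚ) →+ R` is symmetric, kills torsion,
vanishes off the lines and is Galois-equivariant in the coefficients (`h_{σ∘χ} = σ ∘ h_χ`, in
particular `h_{ψ̄} = σ ∘ h_ψ` for the `σ` with `σ ∘ ψ = ψ⁻¹`). Same content as `PSLineHeightData`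
plus the distinguished line `ψ`; no existence asserted. [cite: Benois2020, §0.3 (Definition p0004:L90; Thm. I–III)] -/
def IsPSLineHeight (W : WeierstrassCurve ℚ) {R : Type*} [CommRing R] [Algebra ℚ_[3] R]
    (ψ : DirichletCharacter R 9)
    (h : DirichletCharacter R 9 → W.toAffine.Point →+ W.toAffine.Point →+ R) : Prop :=
  (ψ ^ 3 = 1 ∧ ψ ≠ 1) ∧
  (∀ χ P Q, h χ P Q = h χ Q P) ∧
  (∀ χ P Q, IsOfFinAddOrder P → h χ P Q = 0) ∧
  (∀ χ, ¬ (χ ^ 3 = 1 ∧ χ ≠ 1) → h χ = 0) ∧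
  (∀ (σ : R ≃ₐ[ℚ_[3]] R) χ P Q, h (χ.ringHomComp (σ : R →+* R)) P Q = σ (h χ P Q))

namespace PSLineHeightData

variable (D : PSLineHeightData W R)

/-- The pairings vanish on torsion points in the second variable (from `symm`, `map_torsion`).
[cite: Benois2020, §0.3 (Thm. I, symmetry)] -/
theorem map_torsion_right (χ : DirichletCharacter R 9) (P Q : W.toAffine.Point)
    (hQ : IsOfFinAddOrder Q) : D.pairing χ P Q = 0 := by
  rw [D.symm]
  exact D.map_torsion χ Q P hQ

/-- Off the lines the pairing is zero: `χ³ ≠ 1` gives `h_χ = 0`. [cite: Benois2020, §0.3 (splitting submodules, p0005:L31)] -/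
theorem pairing_eq_zero_of_pow_three_ne_one {χ : DirichletCharacter R 9} (hχ : χ ^ 3 ≠ 1) :
    D.pairing χ = 0 :=
  D.eq_zero_of_not_isLine χ fun h => hχ h.1

/-- The trivial character carries no line: `h_1 = 0`. [cite: Benois2020, §0.3 (splitting submodules, p0005:L31)] -/
theorem pairing_one : D.pairing 1 = 0 :=
  D.eq_zero_of_not_isLine 1 fun h => h.2 rfl

/-- **`h_{σχ}(P,P) = σ (h_χ(P,P))`** — the self-pairings on conjugate lines are conjugate.
[cite: Benois2020, §0.3 (Definition p0004:L90)] -/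
theorem pairing_ringHomComp_self (σ : R ≃ₐ[ℚ_[3]] R) (χ : DirichletCharacter R 9)
    (P : W.toAffine.Point) :
    D.pairing (χ.ringHomComp (σ : R →+* R)) P P = σ (D.pairing χ P P) :=
  D.conj σ χ P P

/-- A conjugate line is degenerate at `(P, Q)` iff the line is. [cite: Benois2020, §0.3 (Definition p0004:L90)] -/
theorem pairing_ringHomComp_eq_zero_iff (σ : R ≃ₐ[ℚ_[3]] R) (χ : DirichletCharacter R 9)
    (P Q : W.toAffine.Point) :
    D.pairing (χ.ringHomComp (σ : R →+* R)) P Q = 0 ↔ D.pairing χ P Q = 0 := by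
  rw [D.conj, map_eq_zero_iff _ σ.injective]

/-- **σ-symmetric non-degeneracy** (the route's use of the conjugation symmetry): if SOME conjugate
line `F_{σχ}` is non-degenerate at `(P, Q)`, then so is `F_χ`. [cite: Benois2020, §0.3 (Definition p0004:L90)] -/
theorem pairing_ne_zero_of_exists_ringHomComp {χ : DirichletCharacter R 9} {P Q : W.toAffine.Point}
    (h : ∃ σ : R ≃ₐ[ℚ_[3]] R, D.pairing (χ.ringHomComp (σ : R →+* R)) P Q ≠ 0) :
    D.pairing χ P Q ≠ 0 := by
  obtain ⟨σ, hσ⟩ := h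
  exact fun h0 => hσ ((D.pairing_ringHomComp_eq_zero_iff σ χ P Q).mpr h0)

/-- **`h_{ψ̄} = σ ∘ h_ψ`**: if `σ ∈ Aut(R/ℚ₃)` carries `ψ` to `ψ̄ = ψ⁻¹` (over `R = ℚ₃(ζ₃)`: the
non-trivial automorphism, `σ(ζ₃) = ζ₃²`), the height on the conjugate line is the conjugate height.
[cite: Benois2020, §0.3 (Definition p0004:L90)] -/
theorem pairing_inv_eq_of_ringHomComp_eq {σ : R ≃ₐ[ℚ_[3]] R} {ψ : DirichletCharacter R 9}
    (hσ : ψ.ringHomComp (σ : R →+* R) = ψ⁻¹) (P Q : W.toAffine.Point) :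
    D.pairing ψ⁻¹ P Q = σ (D.pairing ψ P Q) := by
  rw [← hσ, D.conj]

/-- Under `σ ∘ ψ = ψ⁻¹`: the `ψ̄`-line is non-degenerate at `(P,Q)` iff the `ψ`-line is.
[cite: Benois2020, §0.3 (Definition p0004:L90)] -/
theorem pairing_inv_ne_zero_iff_of_ringHomComp_eq {σ : R ≃ₐ[ℚ_[3]] R} {ψ : DirichletCharacter R 9}
    (hσ : ψ.ringHomComp (σ : R →+* R) = ψ⁻¹) (P Q : W.toAffine.Point) :
    D.pairing ψ⁻¹ P Q ≠ 0 ↔ D.pairing ψ P Q ≠ 0 := by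
  rw [D.pairing_inv_eq_of_ringHomComp_eq hσ, map_ne_zero_iff _ σ.injective]

/-- A datum satisfies `IsPSLineHeight W ψ D.pairing` for every line `ψ`.
[cite: Benois2020, §0.3 (Definition p0004:L90; Thm. I–III)] -/
theorem isPSLineHeight {ψ : DirichletCharacter R 9} (hψ : ψ ^ 3 = 1) (hψ1 : ψ ≠ 1) :
    IsPSLineHeight W ψ D.pairing :=
  ⟨⟨hψ, hψ1⟩, D.symm, D.map_torsion, D.eq_zero_of_not_isLine, D.conj⟩

/-- Conversely a family satisfying `IsPSLineHeight` is a datum.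
[cite: Benois2020, §0.3 (Definition p0004:L90; Thm. I–III)] -/
def ofIsPSLineHeight {ψ : DirichletCharacter R 9}
    {h : DirichletCharacter R 9 → W.toAffine.Point →+ W.toAffine.Point →+ R}
    (hh : IsPSLineHeight W ψ h) : PSLineHeightData W R where
  pairing := h
  symm := hh.2.1
  map_torsion := hh.2.2.1
  eq_zero_of_not_isLine := hh.2.2.2.1
  conj := hh.2.2.2.2

/-- `ofIsPSLineHeight` has the given pairings (unfolding). [cite: Benois2020, §0.3 (Definition p0004:L90)] -/
@[simp]
theorem ofIsPSLineHeight_pairing {ψ : DirichletCharacter R 9}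
    {h : DirichletCharacter R 9 → W.toAffine.Point →+ W.toAffine.Point →+ R}
    (hh : IsPSLineHeight W ψ h) : (ofIsPSLineHeight hh).pairing = h :=
  rfl

variable (W R) in
/-- **Vacuity flag.** The zero family is a datum: the normalisation (Benois's universal-norm /
splitting description, Thm. II–III) is NOT axiomatised, so consumers must quantify over the datum and
must not read `PSLineHeightData W R` as an existence statement. [cite: Benois2020, §0.3 (Thm. II–III)] -/
def zero : PSLineHeightData W R where
  pairing := fun _ => 0
  symm := fun _ _ _ => rfl
  map_torsion := fun _ _ _ _ => rfl
  eq_zero_of_not_isLine := fun _ _ => rfl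
  conj := fun σ _ _ _ => by simp only [AddMonoidHom.zero_apply, map_zero]

/-- The zero datum has all pairings zero (unfolding of the vacuity flag). [cite: Benois2020, §0.3 (Thm. II–III)] -/
@[simp]
theorem zero_pairing (χ : DirichletCharacter R 9) : (zero W R).pairing χ = 0 :=
  rfl

end PSLineHeightData

/-- The distinguished line of an `IsPSLineHeight` family has exact order `3`.
[cite: Benois2020, §0.3 (splitting submodules, p0005:L31)] -/
theorem IsPSLineHeight.pow_three_eq_one {ψ : DirichletCharacter R 9}
    {h : DirichletCharacter R 9 → W.toAffine.Point →+ W.toAffine.Point →+ R}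
    (hh : IsPSLineHeight W ψ h) : ψ ^ 3 = 1 ∧ ψ ≠ 1 :=
  hh.1

/-- `h_{ψ̄} = σ ∘ h_ψ` for an `IsPSLineHeight` family, when `σ ∘ ψ = ψ⁻¹`.
[cite: Benois2020, §0.3 (Definition p0004:L90)] -/
theorem IsPSLineHeight.apply_inv_eq {ψ : DirichletCharacter R 9}
    {h : DirichletCharacter R 9 → W.toAffine.Point →+ W.toAffine.Point →+ R}
    (hh : IsPSLineHeight W ψ h) {σ : R ≃ₐ[ℚ_[3]] R} (hσ : ψ.ringHomComp (σ : R →+* R) = ψ⁻¹)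
    (P Q : W.toAffine.Point) : h ψ⁻¹ P Q = σ (h ψ P Q) := by
  rw [← hσ, hh.2.2.2.2]

end WeierstrassCurve

end
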